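import Literature.Combinatorics.Sahi2008.MeasureMultilinear
import Literature.Combinatorics.Sahi2008.LebesgueLevelSets
import Literature.Probability.Percolation.PositiveAssociationLimits
import Mathlib.MeasureTheory.Measure.Portmanteau
import Mathlib.MeasureTheory.Measure.RegularityCompacts

/-!
# Sahi positivity of order `n` is weakly closed and is determined by continuous monotone test families

Support file of the Sahi cell (`prim-sahi`, typer seat, generation 14; `--supports stmt-CriticalPhenomena-4575`).
Theorems only (no definitions, no named facts, no sorries).  The `E_n` analogue (every order `n`) of
Lindqvist 1988 Thm. 3.1/3.5 and Last–Szekli–Yogeshwaran 2020 Lemma 3.6/Thm. 3.7 for positive association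
(`n = 2`), which the cell's literature seat formalised in
`Literature/Probability/Percolation/PositiveAssociationLimits.lean`.

`msahiE μ n f` (`Literature.Combinatorics.Sahi2008.MeasureFunctional`) is Sahi's multilinear functional
`E_n(f_0,…,f_{n−1})` of a measure; Sahi positivity of order `n` asks `E_n ≥ 0` for nonnegative monotone
families (the conclusion of the cell's theorems; `C_n` = its validity for all FKG / box-TP₂ laws).

* `tendsto_msahiE_of_tendsto_finiteMeasure` / `…_probabilityMeasure` — for a FIXED family of bounded continuous
  functions, `E_n^{μ_k}(f) → E_n^{μ}(f)` under weak convergence (each joint moment `∫ Π_{i∈S} f_i` is the integral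
  of a bounded continuous function; the moment polynomial `momentE` is continuous); hence
  `msahiE_nonneg_of_tendsto_finiteMeasure` / `…_probabilityMeasure`: nonnegativity of `E_n` on a continuous
  family passes to weak limits (any topological measurable space, any filter).
* `msahiE_indicator_nonneg_of_continuous_of_isClosed` — on a finite product of linearly ordered metric spaces
  whose distance is compatible with `max` (`dist a (a ⊔ b) ≤ dist c b` for `c ≤ a`, Rüschendorf/Lindqvist (R1);
  `ℝ`, `[0,1]`), nonnegativity of `E_n` on continuous monotone `[0,1]`-valued families gives it on indicators of
  CLOSED up-sets (the continuous monotone `max(0, 1 − m·d(·,U)) ↓ 1_U`, bounded pointwise limits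
  `msahiE_nonneg_of_tendsto`);
* `msahiE_indicator_nonneg_of_continuous` — … on indicators of MEASURABLE up-sets (inner regularity by compact
  sets, upper closures of compacts are closed, increasing unions, a.e.-equality of all joint moments);
* `msahiE_nonneg_of_continuous` — … on ALL bounded measurable nonnegative monotone families (Lieb–Sahi's
  layer-cake Lemma 2.2, tree `msahiE_nonneg_of_upperSets`);
* `msahiE_nonneg_of_tendsto_of_continuous` — COMBINED: if probability measures `μ_k → μ` weakly and each `μ_k` is
  Sahi-positive of order `n` on continuous monotone families, then `μ` is Sahi-positive of order `n` on all
  bounded measurable monotone families.  Instances `Q_d = [0,1]^d` and `ℝ^d`: companion file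
  `SahiPositivityWeakLimitsCube.lean`.

So the CONCLUSION class of the cell's theorems (order-`n` Sahi-positive laws) is weakly closed on `Q_d`/`ℝ^d`,
like the HYPOTHESIS class (box-TP₂ laws, `SahiBoxTP2WeakLimits.lean`).

No sorries, no new axioms.
-/

noncomputable section

namespace Summit.CriticalPhenomena.PercolationContinuityZ3.Theorems.SahiWeakLimits

open MeasureTheory Set Filter Topology Function Literature.Combinatorics.Sahi2008
open scoped ENNReal unitInterval

/-! ### `E_n` of a continuous bounded family is continuous under weak convergence -/

section WeakLimits

variable {Ω κ : Type*} [MeasurableSpace Ω] [TopologicalSpace Ω] [OpensMeasurableSpace Ω] {L : Filter κ}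

omit [MeasurableSpace Ω] [OpensMeasurableSpace Ω] in
/-- A finite product of bounded continuous real functions, packaged as a bounded continuous function.
[folklore] -/
theorem exists_boundedContinuous_prod {n : ℕ} (f : Fin n → Ω → ℝ) (hfc : ∀ i, Continuous (f i))
    (hfb : ∀ i, ∃ C, ∀ x, |f i x| ≤ C) (S : Finset (Fin n)) :
    ∃ g : BoundedContinuousFunction Ω ℝ, (g : Ω → ℝ) = ∏ i ∈ S, f i := by
  choose C hC using hfb
  have hcont : Continuous (∏ i ∈ S, f i) := by
    rw [show (∏ i ∈ S, f i) = fun x => ∏ i ∈ S, f i x from funext fun x => Finset.prod_apply x S f]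
    exact continuous_finsetProd S fun i _ => hfc i
  have hbd : ∀ x, |(∏ i ∈ S, f i) x| ≤ ∏ i ∈ S, C i := by
    intro x
    rw [Finset.prod_apply, Finset.abs_prod]
    exact Finset.prod_le_prod (fun i _ => abs_nonneg _) fun i _ => hC i x
  refine ⟨BoundedContinuousFunction.mkOfBound ⟨∏ i ∈ S, f i, hcont⟩ (2 * ∏ i ∈ S, C i) fun x y => ?_, rfl⟩
  simp only [ContinuousMap.coe_mk, Real.dist_eq]
  have hx := hbd x
  have hy := hbd y
  calc |(∏ i ∈ S, f i) x - (∏ i ∈ S, f i) y| ≤ |(∏ i ∈ S, f i) x| + |(∏ i ∈ S, f i) y| := abs_sub _ _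
    _ ≤ 2 * ∏ i ∈ S, C i := by linarith

/-- **Joint moments of a bounded continuous family converge under weak convergence of finite measures.**
[folklore] -/
theorem tendsto_moment_of_tendsto_finiteMeasure {μs : κ → FiniteMeasure Ω} {μ : FiniteMeasure Ω}
    (hconv : Tendsto μs L (𝓝 μ)) {n : ℕ} (f : Fin n → Ω → ℝ) (hfc : ∀ i, Continuous (f i))
    (hfb : ∀ i, ∃ C, ∀ x, |f i x| ≤ C) (S : Finset (Fin n)) :
    Tendsto (fun k => ∫ x, (∏ i ∈ S, f i) x ∂(μs k : Measure Ω)) L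
      (𝓝 (∫ x, (∏ i ∈ S, f i) x ∂(μ : Measure Ω))) := by
  obtain ⟨g, hg⟩ := exists_boundedContinuous_prod f hfc hfb S
  have := (FiniteMeasure.tendsto_iff_forall_integral_tendsto.1 hconv) g
  simpa only [← hg] using this

/-- **`E_n` of a fixed bounded continuous family is continuous under weak convergence of finite measures**
(`E_n` is the continuous moment polynomial `momentE` of the joint moments). [this work] -/
theorem tendsto_msahiE_of_tendsto_finiteMeasure {μs : κ → FiniteMeasure Ω} {μ : FiniteMeasure Ω}
    (hconv : Tendsto μs L (𝓝 μ)) {n : ℕ} (f : Fin n → Ω → ℝ) (hfc : ∀ i, Continuous (f i))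
    (hfb : ∀ i, ∃ C, ∀ x, |f i x| ≤ C) :
    Tendsto (fun k => msahiE (μs k : Measure Ω) n f) L (𝓝 (msahiE (μ : Measure Ω) n f)) := by
  have hE : (fun k => msahiE (μs k : Measure Ω) n f) =
      (momentE n) ∘ fun k => fun S : Finset (Fin n) => ∫ x, (∏ i ∈ S, f i) x ∂(μs k : Measure Ω) := by
    funext k
    rw [Function.comp_apply, msahiE_eq_momentE]
  rw [hE, msahiE_eq_momentE]
  exact ((continuous_momentE n).tendsto _).comp
    (tendsto_pi_nhds.2 fun S => tendsto_moment_of_tendsto_finiteMeasure hconv f hfc hfb S)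

/-- **Nonnegativity of `E_n` on a bounded continuous family passes to weak limits of finite measures.**
[this work] -/
theorem msahiE_nonneg_of_tendsto_finiteMeasure [NeBot L] {μs : κ → FiniteMeasure Ω} {μ : FiniteMeasure Ω}
    (hconv : Tendsto μs L (𝓝 μ)) {n : ℕ} (f : Fin n → Ω → ℝ) (hfc : ∀ i, Continuous (f i))
    (hfb : ∀ i, ∃ C, ∀ x, |f i x| ≤ C) (hpos : ∀ᶠ k in L, 0 ≤ msahiE (μs k : Measure Ω) n f) :
    0 ≤ msahiE (μ : Measure Ω) n f :=
  ge_of_tendsto (tendsto_msahiE_of_tendsto_finiteMeasure hconv f hfc hfb) hpos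

/-- Probability-measure form of `tendsto_msahiE_of_tendsto_finiteMeasure`. [this work] -/
theorem tendsto_msahiE_of_tendsto_probabilityMeasure {μs : κ → ProbabilityMeasure Ω}
    {μ : ProbabilityMeasure Ω} (hconv : Tendsto μs L (𝓝 μ)) {n : ℕ} (f : Fin n → Ω → ℝ)
    (hfc : ∀ i, Continuous (f i)) (hfb : ∀ i, ∃ C, ∀ x, |f i x| ≤ C) :
    Tendsto (fun k => msahiE (μs k : Measure Ω) n f) L (𝓝 (msahiE (μ : Measure Ω) n f)) := by
  have := tendsto_msahiE_of_tendsto_finiteMeasure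
    ((ProbabilityMeasure.tendsto_nhds_iff_toFiniteMeasure_tendsto_nhds L).mp hconv) f hfc hfb
  simpa only [Function.comp_apply, ProbabilityMeasure.toMeasure_comp_toFiniteMeasure_eq_toMeasure] using this

/-- **Nonnegativity of `E_n` on a bounded continuous family passes to weak limits of probability measures.**
[this work] -/
theorem msahiE_nonneg_of_tendsto_probabilityMeasure [NeBot L] {μs : κ → ProbabilityMeasure Ω}
    {μ : ProbabilityMeasure Ω} (hconv : Tendsto μs L (𝓝 μ)) {n : ℕ} (f : Fin n → Ω → ℝ)
    (hfc : ∀ i, Continuous (f i)) (hfb : ∀ i, ∃ C, ∀ x, |f i x| ≤ C)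
    (hpos : ∀ᶠ k in L, 0 ≤ msahiE (μs k : Measure Ω) n f) : 0 ≤ msahiE (μ : Measure Ω) n f :=
  ge_of_tendsto (tendsto_msahiE_of_tendsto_probabilityMeasure hconv f hfc hfb) hpos

end WeakLimits

/-! ### Products of (R1) metric chains: continuous monotone approximants of closed up-sets -/

section MetricChains

variable {κ : Type*} [Fintype κ] {F : κ → Type*} [∀ k, LinearOrder (F k)] [∀ k, PseudoMetricSpace (F k)]

/-- In a finite sup-metric product of chains with `dist a (a ⊔ b) ≤ dist c b` for `c ≤ a` ((R1)), the distance
to an increasing set is non-increasing along the order. [folklore; cite: Lindqvist1988, §2 (R1)] -/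
theorem infDist_antitone_of_isUpperSet (hF : ∀ k (a b c : F k), c ≤ a → dist a (a ⊔ b) ≤ dist c b)
    {C : Set (∀ k, F k)} (hC : IsUpperSet C) {x y : ∀ k, F k} (hxy : x ≤ y) :
    Metric.infDist y C ≤ Metric.infDist x C := by
  rcases C.eq_empty_or_nonempty with rfl | hne
  · simp [Metric.infDist_empty]
  refine le_of_forall_pos_lt_add fun ε hε => ?_
  obtain ⟨z, hzC, hz⟩ := (Metric.infDist_lt_iff hne).1 (lt_add_of_pos_right (Metric.infDist x C) hε)
  have hyz : y ⊔ z ∈ C := hC le_sup_right hzC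
  calc Metric.infDist y C ≤ dist y (y ⊔ z) := Metric.infDist_le_dist_of_mem hyz
    _ ≤ dist x z := by
        refine (dist_pi_le_iff dist_nonneg).2 fun k => ?_
        rw [Pi.sup_apply]
        exact (hF k (y k) (z k) (x k) (hxy k)).trans (dist_le_pi_dist x z k)
    _ < Metric.infDist x C + ε := hz

omit [Fintype κ] [∀ k, LinearOrder (F k)] [∀ k, PseudoMetricSpace (F k)] in
/-- The approximants `max(0, 1 − m·d(x,C))` are continuous. [folklore] -/
theorem continuous_upApprox {X : Type*} [PseudoMetricSpace X] (C : Set X) (m : ℕ) :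
    Continuous fun x => max 0 (1 - (m : ℝ) * Metric.infDist x C) :=
  continuous_const.max (continuous_const.sub (continuous_const.mul (Metric.continuous_infDist_pt C)))

omit [Fintype κ] [∀ k, LinearOrder (F k)] [∀ k, PseudoMetricSpace (F k)] in
/-- The approximants converge pointwise to the indicator of a nonempty closed set. [folklore] -/
theorem tendsto_upApprox {X : Type*} [PseudoMetricSpace X] {C : Set X} (hC : IsClosed C) (hne : C.Nonempty)
    (x : X) : Tendsto (fun m : ℕ => max 0 (1 - (m : ℝ) * Metric.infDist x C)) atTop
      (𝓝 (C.indicator (1 : X → ℝ) x)) := by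
  by_cases hx : x ∈ C
  · simp only [Metric.infDist_zero_of_mem hx, mul_zero, sub_zero, max_eq_right zero_le_one,
      Set.indicator_of_mem hx, Pi.one_apply]
    exact tendsto_const_nhds
  · rw [Set.indicator_of_notMem hx]
    have hd : 0 < Metric.infDist x C := by
      have hx' : x ∉ closure C := by rwa [hC.closure_eq]
      have h0 : Metric.infDist x C ≠ 0 := fun h => hx' ((Metric.mem_closure_iff_infDist_zero hne).2 h)
      exact lt_of_le_of_ne Metric.infDist_nonneg (Ne.symm h0)
    refine tendsto_atTop_of_eventually_const (i₀ := ⌈(Metric.infDist x C)⁻¹⌉₊) fun m hm => ?_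
    have hm' : (Metric.infDist x C)⁻¹ ≤ m := (Nat.le_ceil _).trans (by exact_mod_cast hm)
    have h1 : 1 ≤ m * Metric.infDist x C := by
      have := mul_le_mul_of_nonneg_right hm' hd.le
      rwa [inv_mul_cancel₀ hd.ne'] at this
    exact max_eq_left (by linarith)

/-- The approximants of an increasing set are monotone in a product of (R1) metric chains. [folklore] -/
theorem monotone_upApprox (hF : ∀ k (a b c : F k), c ≤ a → dist a (a ⊔ b) ≤ dist c b)
    {C : Set (∀ k, F k)} (hC : IsUpperSet C) (m : ℕ) :
    Monotone fun x : ∀ k, F k => max 0 (1 - (m : ℝ) * Metric.infDist x C) := by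
  intro x y hxy
  refine max_le_max le_rfl (sub_le_sub_left ?_ 1)
  exact mul_le_mul_of_nonneg_left (infDist_antitone_of_isUpperSet hF hC hxy) (Nat.cast_nonneg m)

omit [Fintype κ] [∀ k, LinearOrder (F k)] [∀ k, PseudoMetricSpace (F k)] in
/-- `dist a (a ⊔ b) ≤ dist c b` for `c ≤ a` in `ℝ` ((R1) for the real line). [folklore] -/
theorem real_dist_sup_le (a b c : ℝ) (h : c ≤ a) : dist a (a ⊔ b) ≤ dist c b := by
  rcases le_total b a with hba | hab
  · rw [sup_eq_left.2 hba, dist_self]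
    exact dist_nonneg
  · rw [sup_eq_right.2 hab, Real.dist_eq, Real.dist_eq, abs_of_nonpos (by linarith),
      abs_of_nonpos (by linarith)]
    linarith

omit [Fintype κ] [∀ k, LinearOrder (F k)] [∀ k, PseudoMetricSpace (F k)] in
/-- (R1) for any subset of `ℝ` with the induced order and metric (e.g. `[0,1]`). [folklore] -/
theorem subtype_dist_sup_le {p : ℝ → Prop} (a b c : {x : ℝ // p x}) (h : c ≤ a) :
    dist a (a ⊔ b) ≤ dist c b := by
  rcases le_total b a with hba | hab
  · rw [sup_eq_left.2 hba, dist_self]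
    exact dist_nonneg
  · have hca : (c : ℝ) ≤ a := h
    have hab' : (a : ℝ) ≤ b := hab
    rw [sup_eq_right.2 hab, Subtype.dist_eq, Subtype.dist_eq, Real.dist_eq, Real.dist_eq,
      abs_of_nonpos (by linarith), abs_of_nonpos (by linarith)]
    linarith

/-! ### Continuous monotone test families suffice -/

variable [∀ k, MeasurableSpace (F k)] [∀ k, BorelSpace (F k)] [∀ k, SecondCountableTopology (F k)]
  [∀ k, OrderClosedTopology (F k)]

omit [∀ k, OrderClosedTopology (F k)] in
/-- **Step 1 — closed up-sets.**  If `E_n^μ ≥ 0` on continuous monotone `[0,1]`-valued families, then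
`E_n^μ(1_{U_0},…,1_{U_{n−1}}) ≥ 0` for closed up-sets `U_i` (bounded pointwise limit of the continuous monotone
approximants `max(0, 1 − m·d(·, U_i))`). [this work] -/
theorem msahiE_indicator_nonneg_of_continuous_of_isClosed
    (hF : ∀ k (a b c : F k), c ≤ a → dist a (a ⊔ b) ≤ dist c b) (μ : Measure (∀ k, F k)) [IsFiniteMeasure μ]
    {n : ℕ} (h : ∀ g : Fin n → (∀ k, F k) → ℝ, (∀ i, Continuous (g i)) → (∀ i, Monotone (g i)) →
      (∀ i x, 0 ≤ g i x) → (∀ i x, g i x ≤ 1) → 0 ≤ msahiE μ n g)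
    (U : Fin n → Set (∀ k, F k)) (hUc : ∀ i, IsClosed (U i)) (hUu : ∀ i, IsUpperSet (U i)) :
    0 ≤ msahiE μ n fun i => (U i).indicator 1 := by
  by_cases hne : ∀ i, (U i).Nonempty
  · refine msahiE_nonneg_of_tendsto μ (fun m i x => max 0 (1 - (m : ℝ) * Metric.infDist x (U i))) _
      (fun m i => (continuous_upApprox (U i) m).measurable) (C := 1) (fun m i x => ?_)
      (fun i x => tendsto_upApprox (hUc i) (hne i) x)
      (fun m => h _ (fun i => continuous_upApprox (U i) m) (fun i => monotone_upApprox hF (hUu i) m)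
        (fun i x => le_max_left _ _) fun i x => ?_)
    · rw [abs_of_nonneg (le_max_left _ _)]
      exact max_le zero_le_one (sub_le_self _ (mul_nonneg (Nat.cast_nonneg m) Metric.infDist_nonneg))
    · exact max_le zero_le_one (sub_le_self _ (mul_nonneg (Nat.cast_nonneg m) Metric.infDist_nonneg))
  · push Not at hne
    obtain ⟨i, hi⟩ := hne
    have hz : (fun j => (U j).indicator (1 : (∀ k, F k) → ℝ)) i = 0 := by
      funext x
      simp only [hi, Set.indicator_empty, Pi.zero_apply]
    rw [msahiE_eq_zero_of_slot_zero μ _ hz]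

/-- Along an increasing union, indicators converge pointwise (they are eventually constant). [folklore] -/
theorem tendsto_indicator_of_monotone {X : Type*} {A : ℕ → Set X} (hA : Monotone A) (x : X) :
    Tendsto (fun m => (A m).indicator (1 : X → ℝ) x) atTop (𝓝 ((⋃ m, A m).indicator (1 : X → ℝ) x)) := by
  by_cases hx : x ∈ ⋃ m, A m
  · obtain ⟨m₀, hm₀⟩ := mem_iUnion.1 hx
    rw [Set.indicator_of_mem hx]
    refine tendsto_atTop_of_eventually_const (i₀ := m₀) fun m hm => ?_
    rw [Set.indicator_of_mem (hA hm hm₀)]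
  · rw [Set.indicator_of_notMem hx]
    have : ∀ m, x ∉ A m := fun m hm => hx (mem_iUnion.2 ⟨m, hm⟩)
    simp only [Set.indicator_of_notMem (this _)]
    exact tendsto_const_nhds

omit [Fintype κ] [∀ k, PseudoMetricSpace (F k)] [∀ k, MeasurableSpace (F k)] [∀ k, BorelSpace (F k)]
  [∀ k, SecondCountableTopology (F k)] [∀ k, OrderClosedTopology (F k)] in
/-- Upper closure is monotone for set inclusion. [folklore] -/
theorem coe_upperClosure_mono {X : Type*} [Preorder X] {s t : Set X} (hst : s ⊆ t) :
    (upperClosure s : Set X) ⊆ upperClosure t := fun x hx => by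
  obtain ⟨a, ha, hax⟩ := mem_upperClosure.1 hx
  exact mem_upperClosure.2 ⟨a, hst ha, hax⟩

/-- **Step 2 — measurable up-sets.**  If `E_n^μ ≥ 0` on continuous monotone `[0,1]`-valued families (`μ` finite,
inner regular by compact sets — automatic on Polish spaces), then `E_n^μ(1_{U_0},…,1_{U_{n−1}}) ≥ 0` for
measurable up-sets `U_i`: each `U_i` contains an increasing sequence of closed up-sets (upper closures of
compact inner approximations) exhausting it up to a null set; Step 1, the bounded pointwise limit, and
a.e.-equality of all joint moments. [this work] -/
theorem msahiE_indicator_nonneg_of_continuous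
    (hF : ∀ k (a b c : F k), c ≤ a → dist a (a ⊔ b) ≤ dist c b) (μ : Measure (∀ k, F k)) [IsFiniteMeasure μ]
    [μ.InnerRegularCompactLTTop] {n : ℕ}
    (h : ∀ g : Fin n → (∀ k, F k) → ℝ, (∀ i, Continuous (g i)) → (∀ i, Monotone (g i)) →
      (∀ i x, 0 ≤ g i x) → (∀ i x, g i x ≤ 1) → 0 ≤ msahiE μ n g)
    (U : Fin n → Set (∀ k, F k)) (hUm : ∀ i, MeasurableSet (U i)) (hUu : ∀ i, IsUpperSet (U i)) :
    0 ≤ msahiE μ n fun i => (U i).indicator 1 := by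
  -- compact inner approximations `K i m ⊆ U i` with `μ (U i \ K i m) < (m+1)⁻¹`
  have key : ∀ i (m : ℕ), ∃ K, K ⊆ U i ∧ IsCompact K ∧ μ (U i \ K) < ((m : ℝ≥0∞) + 1)⁻¹ := fun i m =>
    (hUm i).exists_isCompact_sdiff_lt (measure_ne_top μ _)
      (ENNReal.inv_ne_zero.2 (by exact ENNReal.add_ne_top.2 ⟨ENNReal.natCast_ne_top m, ENNReal.one_ne_top⟩))
  choose K hKU hKc hKμ using key
  -- closed up-sets `C i m = ↑(K i 0 ∪ … ∪ K i m)`, increasing in `m`, inside `U i`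
  set C : Fin n → ℕ → Set (∀ k, F k) := fun i m => (upperClosure (accumulate (K i) m) : Set (∀ k, F k))
    with hCdef
  have hCc : ∀ i m, IsClosed (C i m) := fun i m =>
    Literature.Probability.Percolation.isClosed_upperClosure_of_isCompact
      (isCompact_accumulate (hKc i) m)
  have hCu : ∀ i m, IsUpperSet (C i m) := fun i m => (upperClosure _).upper
  have hCU : ∀ i m, C i m ⊆ U i := fun i m x hx => by
    obtain ⟨a, ha, hax⟩ := mem_upperClosure.1 hx
    obtain ⟨j, -, hj⟩ := mem_accumulate.1 ha
    exact hUu i hax (hKU i j hj)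
  have hCmono : ∀ i, Monotone (C i) := fun i m m' hmm' => coe_upperClosure_mono (monotone_accumulate hmm')
  have hKC : ∀ i m, K i m ⊆ C i m := fun i m =>
    (subset_accumulate (s := K i)).trans subset_upperClosure
  -- the exhausted up-sets `V i = ⋃ m, C i m`
  set V : Fin n → Set (∀ k, F k) := fun i => ⋃ m, C i m with hVdef
  have hVU : ∀ i, V i ⊆ U i := fun i => iUnion_subset fun m => hCU i m
  have hVm : ∀ i, MeasurableSet (V i) := fun i => MeasurableSet.iUnion fun m => (hCc i m).measurableSet
  -- Step 1 along the increasing closed up-sets, bounded pointwise limit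
  have hposV : 0 ≤ msahiE μ n fun i => (V i).indicator 1 := by
    refine msahiE_nonneg_of_tendsto μ (fun m i => (C i m).indicator 1) _
      (fun m i => (measurable_one.indicator (hCc i m).measurableSet)) (C := 1) (fun m i x => ?_)
      (fun i x => tendsto_indicator_of_monotone (hCmono i) x)
      (fun m => msahiE_indicator_nonneg_of_continuous_of_isClosed hF μ h (fun i => C i m)
        (fun i => hCc i m) fun i => hCu i m)
    by_cases hx : x ∈ C i m
    · simp [Set.indicator_of_mem hx]
    · simp [Set.indicator_of_notMem hx]
  -- `U i` and `V i` differ by a null set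
  have hnull : ∀ i, μ (U i \ V i) = 0 := by
    intro i
    by_contra h0
    obtain ⟨N, hN⟩ := ENNReal.exists_inv_nat_lt h0
    have h1 : μ (U i \ V i) ≤ μ (U i \ K i N) :=
      measure_mono (sdiff_subset_sdiff_right ((hKC i N).trans (subset_iUnion (C i) N)))
    have h2 : ((N : ℝ≥0∞) + 1)⁻¹ ≤ (N : ℝ≥0∞)⁻¹ := ENNReal.inv_le_inv.2 le_self_add
    exact (lt_irrefl _) ((hN.trans_le h1).trans (hKμ i N) |>.trans_le h2)
  have hae : ∀ i, (U i).indicator (1 : (∀ k, F k) → ℝ) =ᵐ[μ] (V i).indicator 1 := by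
    intro i
    refine indicator_ae_eq_of_ae_eq_set ?_
    refine (ae_eq_set).2 ⟨hnull i, ?_⟩
    rw [sdiff_eq_empty.2 (hVU i), measure_empty]
  -- all joint moments agree
  rw [msahiE_congr_of_moments μ μ (fun i => (U i).indicator 1) (fun i => (V i).indicator 1) fun S => ?_]
  · exact hposV
  refine integral_congr_ae ?_
  have hall : ∀ᵐ x ∂μ, ∀ i, (U i).indicator (1 : (∀ k, F k) → ℝ) x = (V i).indicator 1 x :=
    ae_all_iff.2 fun i => hae i
  filter_upwards [hall] with x hx
  simp only [Finset.prod_apply]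
  exact Finset.prod_congr rfl fun i _ => hx i

/-- **Continuous monotone test families suffice for Sahi positivity of order `n`** (the `E_n` analogue of
Last–Szekli–Yogeshwaran's Lemma 3.6 / Lindqvist's Thm. 3.1): on a finite product of (R1) metric chains with closed
order, a finite measure `μ`, inner regular by compact sets, with `E_n^μ ≥ 0` on all CONTINUOUS monotone
`[0,1]`-valued families has `E_n^μ ≥ 0` on all bounded measurable nonnegative monotone families
(Step 2 + Lieb–Sahi's layer-cake Lemma 2.2, tree `msahiE_nonneg_of_upperSets`). [this work] -/
theorem msahiE_nonneg_of_continuous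
    (hF : ∀ k (a b c : F k), c ≤ a → dist a (a ⊔ b) ≤ dist c b) (μ : Measure (∀ k, F k)) [IsFiniteMeasure μ]
    [μ.InnerRegularCompactLTTop] {n : ℕ}
    (h : ∀ g : Fin n → (∀ k, F k) → ℝ, (∀ i, Continuous (g i)) → (∀ i, Monotone (g i)) →
      (∀ i x, 0 ≤ g i x) → (∀ i x, g i x ≤ 1) → 0 ≤ msahiE μ n g)
    (f : Fin n → (∀ k, F k) → ℝ) (hfm : ∀ i, Measurable (f i)) (hf0 : ∀ i x, 0 ≤ f i x) {B : ℝ}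
    (hfB : ∀ i x, f i x ≤ B) (hmono : ∀ i, Monotone (f i)) : 0 ≤ msahiE μ n f :=
  msahiE_nonneg_of_upperSets μ
    (fun U hUu hUm => msahiE_indicator_nonneg_of_continuous hF μ h U hUm hUu) f hf0 hfB hmono
    fun i _ => measurableSet_lt measurable_const (hfm i)

/-- **Weak limits of order-`n` Sahi-positive laws are order-`n` Sahi-positive** on a finite product of (R1)
metric chains: if probability measures `μ_k → μ` weakly and each `μ_k` has `E_n ≥ 0` on continuous monotone
`[0,1]`-valued families, then `μ` has `E_n ≥ 0` on all bounded measurable nonnegative monotone families.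
[this work] -/
theorem msahiE_nonneg_of_tendsto_of_continuous
    (hF : ∀ k (a b c : F k), c ≤ a → dist a (a ⊔ b) ≤ dist c b) {ι : Type*} {L : Filter ι} [NeBot L]
    {μs : ι → ProbabilityMeasure (∀ k, F k)} {μ : ProbabilityMeasure (∀ k, F k)} (hconv : Tendsto μs L (𝓝 μ))
    [(μ : Measure (∀ k, F k)).InnerRegularCompactLTTop] {n : ℕ}
    (h : ∀ᶠ k in L, ∀ g : Fin n → (∀ k, F k) → ℝ, (∀ i, Continuous (g i)) → (∀ i, Monotone (g i)) →
      (∀ i x, 0 ≤ g i x) → (∀ i x, g i x ≤ 1) → 0 ≤ msahiE (μs k : Measure (∀ k, F k)) n g)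
    (f : Fin n → (∀ k, F k) → ℝ) (hfm : ∀ i, Measurable (f i)) (hf0 : ∀ i x, 0 ≤ f i x) {B : ℝ}
    (hfB : ∀ i x, f i x ≤ B) (hmono : ∀ i, Monotone (f i)) : 0 ≤ msahiE (μ : Measure (∀ k, F k)) n f :=
  msahiE_nonneg_of_continuous hF (μ : Measure (∀ k, F k))
    (fun g hgc hgm hg0 hg1 => msahiE_nonneg_of_tendsto_probabilityMeasure hconv g hgc
      (fun i => ⟨1, fun x => by rw [abs_of_nonneg (hg0 i x)]; exact hg1 i x⟩)
      (h.mono fun k hk => hk g hgc hgm hg0 hg1))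
    f hfm hf0 hfB hmono

end MetricChains

end Summit.CriticalPhenomena.PercolationContinuityZ3.Theorems.SahiWeakLimits
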